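import Summits.CriticalPhenomena.PercolationContinuityZ3.Theorems.Transplant.SkelFrmBChoiceDefsT
import Summits.CriticalPhenomena.PercolationContinuityZ3.Theorems.Transplant.SkelNeg1ChoiceAll
import HarnessLib

/-!
# N2 (frames-only node `SamePDropOfSkeletonFrm₁`, OPEN), WAVE 1 under (R-40): THE GEOMETRIC OBLIGATION OF THE CHOICE FUNCTION OF RECORD —
# `PlanarSkeletonFrm.geomHoldsNQFn_frmChoiceAllQ3T : ∀ gv fv Pv Sv cv bv, GeomHoldsNQFn (frmChoiceAllQ3T gv fv Pv Sv cv bv)` (1 of the 4 column obligations)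

The (R-40) `…T` twin of `SkelFrmBChoiceGeom` (p350212, the Geom column of record over `PCells2S`): the same three steps over the PER-AXIS-capped staggered cells
`NegB.fcellsT` and hp-8 g42's T scheme geometry `Skelφ.cellGeomSG₂bT / faceDataSGT / levelDataST` (SkelPhiCellsSmallMT / WeakGLevelsT / FineGeomT): the column point
over the T-staggered centre from `Skelφ.hcol_fineSkelT`, the nine `GeomHoldsN` conjuncts from `runGeomSG₂bT / anchGeomSG₂bT / sepGeom₂SG₂bT / exitGeomSG₂bT /
stepsGeomSG₂bT / levelGeomSG₂bT`, and the obligation at the choice function of record `frmChoiceAllQ3T` for EVERY slot value (`bOf ≤ 3r` by `bOf_leT`, the column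
floor at the T-staggered centre by `colQ_schedOfT`, `EqNumL` from `FactsNS`).  The fine map is the UNCHANGED (ζ′) map `fineA` / `fineOA` ((R-22) option (i-a)).
* §1 `hcol_fineA_atT`, `hcol_fineA_of_schedT`; §2 **`geom_fineA_at_bT`** (the nine conjuncts, map slot `φ′`, any `b₀ ≤ 3r`, any creep value);
* §3 **`geomHoldsNQFn_frmChoiceAllQ3T`** — the Geom column obligation AT THE CHOICE FUNCTION OF RECORD (lead g11 06:35:07Z: wrappers at `frmChoiceAllQ3T` only).
NON-VACUITY (lead g11 standing order 03:52:56Z): an unconditional `∀ slots` theorem — it IS its own witness at every closed slot tuple.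
builds on p205010 (kernel theorem, internal audit signed; external expert review pending) — nothing in this file uses p205010; NOTHING is claimed about the open node
`SamePDropOfSkeletonFrm₁` (`SamePDropOfSkeletonNeg₁` is CLOSED in the tree and untouched by this file).
Lane `prim-bschramm`, seat `prim-bschramm-stmt` (gen 21); helper file (`--supports stmt-CriticalPhenomena-4575 --as helper`); rulings (R-31) (slots), (R-33) (cube), (R-40)
(per-axis cap; design owner p3-g16; T port owner hp-8 g42).
[cite: KozmaNitzan2024, §4 pp. 25–29 (Q_v, M_v, E_{v,x}, H^j_{v,x}; (29): columns)] [cite: MartineauTassion2017, §4.3]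
-/

noncomputable section

open scoped Classical

namespace Summit.CriticalPhenomena.PercolationContinuityZ3.Theorems.Transplant

open MeasureTheory Literature.Probability.Percolation Literature.Probability.LatticeModels SimpleGraph KNCells
open Literature.Barriers.CriticalPhenomena (HasExponentialGrowth graphBall)

namespace PlanarSkeletonFrm

open SkelConc (Consts)
open BoxProdZ2 (ConcRadiiG)
open Skelφ (oriφ trφ)
open Skelφ.StepI (DataN DataNS OutNS)

namespace NegB

open Neg

section Geom

variable (κ : Consts) {V : Type} [DecidableEq V] [Countable V] {G : SimpleGraph V} [G.LocallyFinite] (Φ : PlanarSkeletonFrm G) (t : V)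
  (p : unitInterval) (D : DataNS V) (g f : ℕ) (c : Fin 2 → ℕ)

/-! ## §1 The column point over the T-staggered centre -/

/-- **THE COLUMN POINT over the T-STAGGERED centre** for the fine map of the (ζ′) chain: for every cube `Q x` of the staggered cells `fcellsT … c` and every radius
`R ≥ NrepA (cenS x) + 1`, a vertex of fine position exactly `cenS x` inside the window span `VWin (Q x) R`. [cite: KozmaNitzan2024, §4 p. 26 ((29): columns)] -/
theorem hcol_fineA_atT {φ' : V → Site 2} (hlip : Skelφ.Lip G φ') (hstep : Skelφ.Steps G φ') (hN : EqNumL κ Φ t p D g f) (x : Site 2) {R : ℕ}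
    (hR : NrepA κ Φ t p D g f ((fcellsT κ Φ t p D g f c).cenS x) + 1 ≤ R) :
    ∃ y ∈ Skelφ.VWin G (fineA κ Φ t p D g f φ') t ((fcellsT κ Φ t p D g f c).Q x) R, fineA κ Φ t p D g f φ' y = (fcellsT κ Φ t p D g f c).cenS x := by
  obtain ⟨hn1, hℓ1⟩ := one_le_of_eqNumL κ Φ t p D g f hN
  obtain ⟨r0, r1⟩ := room_fcellsA_at κ Φ t p D g f hN
  have hD := Skelφ.NegPrm.DofA_pos (Aof_pos κ).2 hn1 hℓ1 (hL κ Φ t p D g f) (vL κ Φ t p D g f)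
  exact Skelφ.hcol_fineSkelT (A := Aof κ) (n := (nL κ Φ t p D g f : ℤ)) (h := hL κ Φ t p D g f) (vα := vL κ Φ t p D g f) (vβ := vβL κ Φ t p D g f) hlip hstep t
    (cA_pos κ Φ t p D g f 0) (cA_pos κ Φ t p D g f 1) hD r0 r1 (fcellsT κ Φ t p D g f c) x hR

/-- **`hcol` in the shape `sepGeomSG₂T` consumes**, from a schedule whose cube radii dominate the column radius at the T-staggered centres. [folklore] -/
theorem hcol_fineA_of_schedT {φ' : V → Site 2} (hlip : Skelφ.Lip G φ') (hstep : Skelφ.Steps G φ') (hN : EqNumL κ Φ t p D g f) {Λ : ConcRadiiG}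
    (hcolQ : ∀ a x, NrepA κ Φ t p D g f ((fcellsT κ Φ t p D g f c).cenS x) + 1 ≤ Λ.rQ a x) :
    ∀ a x, ∃ y ∈ Skelφ.VWin G (fineA κ Φ t p D g f φ') t ((fcellsT κ Φ t p D g f c).Q x) (Λ.rQ a x),
      fineA κ Φ t p D g f φ' y = (fcellsT κ Φ t p D g f c).cenS x :=
  fun a x => hcol_fineA_atT κ Φ t p D g f c hlip hstep hN x (hcolQ a x)

/-! ## §2 The nine conjuncts for the T-staggered cells with small boxes -/

/-- **THE NINE `GeomHoldsN` CONJUNCTS FOR THE T-STAGGERED CELLS WITH SMALL BOXES, map slot `φ′`** (`cellGeomSG₂bT … b₀` for any `b₀ ≤ 3r`, any creep value `c`).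
[cite: KozmaNitzan2024, §4 pp. 25–29] -/
theorem geom_fineA_at_bT {φ' : V → Site 2} (hlip : Skelφ.Lip G φ') (hstep : Skelφ.Steps G φ') (hN : EqNumL κ Φ t p D g f) {Λ : ConcRadiiG}
    (hΛ : Skelφ.WFS2 (fcellsT κ Φ t p D g f c).toPCells2 Λ) (hcolQ : ∀ a x, NrepA κ Φ t p D g f ((fcellsT κ Φ t p D g f c).cenS x) + 1 ≤ Λ.rQ a x)
    {b₀ : Fin 2 → ℕ} (hb : ∀ i, b₀ i ≤ 3 * (fcellsT κ Φ t p D g f c).r i) :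
    (Skelφ.cellGeomSG₂bT G (fineA κ Φ t p D g f φ') (fcellsT κ Φ t p D g f c) t Λ b₀).root = t ∧
      κ.K₀ ≤ (Skelφ.cellGeomSG₂bT G (fineA κ Φ t p D g f φ') (fcellsT κ Φ t p D g f c) t Λ b₀).K ∧
      Skelφ.Lip G (fineA κ Φ t p D g f φ') ∧
      RunGeom G (Skelφ.cellGeomSG₂bT G (fineA κ Φ t p D g f φ') (fcellsT κ Φ t p D g f c) t Λ b₀) ∧
      AnchGeom (Skelφ.cellGeomSG₂bT G (fineA κ Φ t p D g f φ') (fcellsT κ Φ t p D g f c) t Λ b₀) ∧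
      SepGeom₂ G (Skelφ.cellGeomSG₂bT G (fineA κ Φ t p D g f φ') (fcellsT κ Φ t p D g f c) t Λ b₀) ∧
      ExitGeom G (Skelφ.cellGeomSG₂bT G (fineA κ Φ t p D g f φ') (fcellsT κ Φ t p D g f c) t Λ b₀) ∧
      StepsGeom (Skelφ.cellGeomSG₂bT G (fineA κ Φ t p D g f φ') (fcellsT κ Φ t p D g f c) t Λ b₀)
        (Skelφ.faceDataSGT G (fineA κ Φ t p D g f φ') (fcellsT κ Φ t p D g f c) t Λ) ∧
      LevelGeom G (Skelφ.cellGeomSG₂bT G (fineA κ Φ t p D g f φ') (fcellsT κ Φ t p D g f c) t Λ b₀)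
        (Skelφ.faceDataSGT G (fineA κ Φ t p D g f φ') (fcellsT κ Φ t p D g f c) t Λ)
        (Skelφ.levelDataST (fineA κ Φ t p D g f φ') (fcellsT κ Φ t p D g f c)) := by
  have hψ0 := fineA_base_at κ Φ t p D g f φ' hN
  have hlipψ := lip_fineA_at κ Φ t p D g f hlip hN
  have hws := weakSteps_fineA_at κ Φ t p D g f hstep hN
  have hcol := hcol_fineA_of_schedT κ Φ t p D g f c hlip hstep hN hcolQ
  refine ⟨rfl, (fcellsA_K κ Φ t p D g f).2.1, hlipψ, Skelφ.runGeomSG₂bT _ _ _, Skelφ.anchGeomSG₂bT _ _ _,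
    Skelφ.sepGeom₂SG₂bT _ _ _ hΛ hψ0 hlipψ hws hcol, Skelφ.exitGeomSG₂bT _ _ _ hΛ hlipψ hb, Skelφ.stepsGeomSG₂bT _ _ _ hΛ hlipψ hws hb,
    Skelφ.levelGeomSG₂bT _ _ _ hΛ hlipψ hb⟩

end Geom

end NegB

/-! ## §3 The geometric obligation of the choice function of record under (R-40) -/

/-- **`GeomHoldsNQFn (frmChoiceAllQ3T gv fv Pv Sv cv bv)` FOR EVERY SLOT VALUE** — the Geom column obligation of the node theorem at THE CHOICE FUNCTION OF RECORD
(the T scheme over the per-axis-capped staggered cells; `bOf ≤ 3r` by `bOf_leT`, the column floor at the T-staggered centre by `colQ_schedOfT`, the long clause from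
`FactsNS`). [cite: KozmaNitzan2024, §4 pp. 25–29] -/
theorem geomHoldsNQFn_frmChoiceAllQ3T (gv fv : Neg.FSlot) (Pv : NegB.PSlot) (Sv : NegB.SSlot) (cv : NegB.CSlot) (bv : NegB.BSlot) :
    GeomHoldsNQFn (frmChoiceAllQ3T gv fv Pv Sv cv bv) := by
  intro κ V _ _ G _ Φ hg t ht h1 p hp0 hp1 hC O q hAt
  obtain ⟨-, -, hR, -, -⟩ := Skelφ.StepI.OutO.FactsO.shared hAt.1.factsO
  obtain ⟨h1', h2, -, h4, h5, h6, h7, h8, h9⟩ := NegB.geom_fineA_at_bT κ Φ t p O.merged (NegB.gOf κ Φ t p O gv) (NegB.fOf κ Φ t p O fv)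
    (NegB.cOf κ Φ t p O gv fv cv)
    (NegB.lip_φL κ Φ t p O.D O.DT.toDataN O.ori (NegB.gOf κ Φ t p O gv) (NegB.fOf κ Φ t p O fv))
    (NegB.steps_φL κ Φ t p O.D O.DT.toDataN O.ori (NegB.gOf κ Φ t p O gv) (NegB.fOf κ Φ t p O fv))
    (NegB.eqNumL_of_factsO κ Φ t p O.D O.DT.toDataN O.ori _ _ hR (Skelφ.StepI.OutO.FactsO.clauses hAt.1.factsO))
    (NegB.schedOfT_WFS2 κ Φ t p O.merged (NegB.gOf κ Φ t p O gv) (NegB.fOf κ Φ t p O fv) (NegB.cOf κ Φ t p O gv fv cv)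
      (Sv κ Φ t p O.merged (NegB.gOf κ Φ t p O gv) (NegB.fOf κ Φ t p O fv) q))
    (NegB.colQ_schedOfT κ Φ t p O.merged (NegB.gOf κ Φ t p O gv) (NegB.fOf κ Φ t p O fv) (NegB.cOf κ Φ t p O gv fv cv)
      (Sv κ Φ t p O.merged (NegB.gOf κ Φ t p O gv) (NegB.fOf κ Φ t p O fv) q))
    (NegB.bOf_leT κ Φ t p O gv fv cv bv)
  exact ⟨h1', h2, h4, h5, h6, h7, h8, h9⟩

end PlanarSkeletonFrm

end Summit.CriticalPhenomena.PercolationContinuityZ3.Theorems.Transplant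

end
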